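import Mathlib
import HarnessLib
import Summits.HubbardSuperconductivity.HubbardSuperconductivity.Theorems.KLProgrammeKLRegimeEngineScaleZeroResummedDecay
import Summits.HubbardSuperconductivity.HubbardSuperconductivity.Theorems.KLProgrammeKLRegimeEngineScaleZeroValuesExplicit
import Summits.HubbardSuperconductivity.HubbardSuperconductivity.Theorems.KLProgrammeKLRegimeEngineScaleZeroThetaPackage
import Summits.HubbardSuperconductivity.HubbardSuperconductivity.Theorems.KLProgrammeKLRegimeEngineV8DefsU4

/-!
# K3 engine (gen-6 item `KLRegimeEngineV16`, stmt-HubbardSuperconductivity-20236), stub `stub_twoLeg_scale0` under (ρ2): the UNWEIGHTED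
# decay constant of the counterterm-dressed scale-`0` grid covariance AT THE ENGINE'S PACKAGE — `≤ 2·(N/β)·klScaleZeroA0` below `klEngU₀3`

Cell gate-hubbard-kl, seat p3 g8 ((ρ2)(iii)-DECAY, part 3: the smallness numeral).  Part 1 (`…EngineScaleZeroResummedDecay`) bounds the
row / column sums of the dressed grid covariance `M'·G`, `M'·(1 + G·S) = 1`, by `α/(1 − α·ν)` from those of `G` (`α`) and of the counterterm
matrix (`ν`).  At scale `0` both constants are CLOSED at the engine's data: `α = (N/β)·klScaleZeroA0` for `G = S_Nᵀ C^K_{>e₀} S_N` on the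
`N = 4M` grid (`rowSum_scaleZero_le_A0`, k3c4-p2 / p3 g6 / k3c2-p1; `klScaleZeroA0 ≤ 2^43`), and `ν = (β/N)·klKappaFrameC R·|U|`
(`sum_norm_framePosKernel_le_linear_of_frameOK`, `klKappaFrameC R ≤ 2^13(Gfr0+1)(Gfr2+1) ≤ 2^15·Rsq²`); `β` and `N` cancel in `α·ν`, and below
the engine threshold `U ≤ klEngU₀3 P R c = 2^{-120}/(Psq²Rsq⁴(c²+1))` (a fortiori below `klEngU₀4`) the product is `≤ 2^{-62} ≤ 1/2`:

* `klScaleZeroA0_mul_klKappaFrameC_mul_le_half` — `klScaleZeroA0·klKappaFrameC R·U ≤ 1/2` for `R.WF`, `0 < U ≤ klEngU₀3 P R c`;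
* **`rowSum_resummedScaleZeroCov_le_of_klEng` / `colSum_…`** — for an admissible frame (`FrameOK R U Nsc μ K`), `klBetaMin ≤ β`, `β³ ≤ M`,
  `0 < U ≤ klEngU₀3 P R c`, EVERY `S` dominated by the grid counterterm matrix (`‖S X Y‖ ≤ ‖N_g X Y‖ + ‖N_g Y X‖`, `N_g = gridCounterMatrix L (4M) β K`)
  and EVERY `M'` with `M'·(1 + G·S) = 1`: `Σ_Y ‖(M'·G) X Y‖ ≤ 2·((4M)/β)·klScaleZeroA0` (and columns) — the plain `α` of the resummed W-chain
  is twice the bare one; `isUnit_one_add_scaleZeroCov_mul_of_klEng` gives the dressing; `…_of_klEngU₀4` doors for the registered binder.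

The WEIGHTED twin (`gridLabelWt`, `α_w`) is part 1's `rowSum_resummedGridCov_le_two_mul` once (E4)₀'s `α_w` is a closed term (k3c2-p1).
Everything is proved; no definitions, no named facts, no sorry.  `--supports stmt-HubbardSuperconductivity-20236` (helper).
-/

noncomputable section

namespace Summit.HubbardSuperconductivity.HubbardSuperconductivity.Theorems.EngineV8

set_option linter.dupNamespace false -- summit = problem name (single-conjunct summit), D-0017

open Real Finset Literature.MathematicalPhysics.QuantumLattice Literature.Probability.LatticeModels
open Summit.HubbardSuperconductivity.HubbardSuperconductivity.Theorems.KLRegimeSplit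
open Summit.HubbardSuperconductivity.HubbardSuperconductivity.Theorems.KLProgrammeLegKernels
open Summit.HubbardSuperconductivity.HubbardSuperconductivity.Theorems.ScaleZeroDecay

/-! ## §1 The smallness numeral `klScaleZeroA0 · klKappaFrameC R · U ≤ 1/2` below `klEngU₀3` -/

/-- **The scale-`0` resummation smallness below the engine threshold**: `R.WF`, `0 < U ≤ klEngU₀3 P R c` ⇒
`klScaleZeroA0·(klKappaFrameC R·U) ≤ 1/2` (`2^43 · 2^13·4Rsq² · 2^{-120}/Rsq⁴ = 2^{-62}/Rsq²`). -/
theorem klScaleZeroA0_mul_klKappaFrameC_mul_le_half {P : SplitConsts} {R : RenConsts} (hR : R.WF) {c U : ℝ} (hU : 0 < U)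
    (hU₀ : U ≤ klEngU₀3 P R c) : klScaleZeroA0 * (klKappaFrameC R * U) ≤ 1 / 2 := by
  have hG := hR.2.2
  have hA := klScaleZeroA0_le_two_pow
  have hA0 := klScaleZeroA0_pos.le
  have hκ := klKappaFrameC_le (hG 0) (hG 2)
  have hκ0 := (klKappaFrameC_pos (hG 0)).le
  have hRsq1 : 1 ≤ klEngRsq R := one_le_klEngRsq R
  have hPsq1 : 1 ≤ klEngPsq P := one_le_klEngPsq P
  have hden : (2 : ℝ) ^ 120 * klEngRsq R ^ 4 ≤ (2 : ℝ) ^ 120 * klEngPsq P ^ 2 * klEngRsq R ^ 4 * (c ^ 2 + 1) := by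
    have h2' : (1 : ℝ) ≤ klEngPsq P ^ 2 := one_le_pow₀ hPsq1
    have h3 : (1 : ℝ) ≤ c ^ 2 + 1 := by nlinarith [sq_nonneg c]
    have hR0 : 0 ≤ klEngRsq R ^ 4 := by positivity
    calc (2 : ℝ) ^ 120 * klEngRsq R ^ 4 = (2 : ℝ) ^ 120 * 1 * klEngRsq R ^ 4 * 1 := by ring
      _ ≤ _ := by gcongr
  have hUle : U ≤ 1 / ((2 : ℝ) ^ 120 * klEngRsq R ^ 4) := by
    refine hU₀.trans ?_
    rw [klEngU₀3]
    exact one_div_le_one_div_of_le (by positivity) hden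
  have hb : (R.Gfr 0 + 1) * (R.Gfr 2 + 1) ≤ 4 * klEngRsq R ^ 2 := by
    have hG0 : R.Gfr 0 ≤ klEngRsq R := gfr_le_klEngRsq R (by norm_num)
    have hG2 : R.Gfr 2 ≤ klEngRsq R := gfr_le_klEngRsq R (by norm_num)
    nlinarith [hG 0, hG 2]
  have hAκ : klScaleZeroA0 * klKappaFrameC R ≤ (2 : ℝ) ^ 43 * ((2 : ℝ) ^ 13 * (4 * klEngRsq R ^ 2)) :=
    mul_le_mul hA (hκ.trans (by nlinarith)) hκ0 (by positivity)
  calc klScaleZeroA0 * (klKappaFrameC R * U) = (klScaleZeroA0 * klKappaFrameC R) * U := by ring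
    _ ≤ ((2 : ℝ) ^ 43 * ((2 : ℝ) ^ 13 * (4 * klEngRsq R ^ 2))) * (1 / ((2 : ℝ) ^ 120 * klEngRsq R ^ 4)) :=
        mul_le_mul hAκ hUle hU.le (by positivity)
    _ = 1 / ((2 : ℝ) ^ 62 * klEngRsq R ^ 2) := by field_simp; ring
    _ ≤ 1 / (2 : ℝ) ^ 62 := by
        refine one_div_le_one_div_of_le (by positivity) ?_
        have : (1 : ℝ) ≤ klEngRsq R ^ 2 := one_le_pow₀ hRsq1
        nlinarith
    _ ≤ 1 / 2 := by norm_num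

/-- `U ≤ klEngU₀3 P R c ⇒ |U| ≤ 1` for `0 < U` (`klEngU₀3 ≤ 2^{-120}`). -/
theorem abs_le_one_of_le_klEngU₀3 {P : SplitConsts} {R : RenConsts} {c U : ℝ} (hU : 0 < U) (hU₀ : U ≤ klEngU₀3 P R c) : |U| ≤ 1 := by
  rw [abs_of_pos hU]
  refine hU₀.trans ((klEngU₀3_le_two_pow P R c).trans ?_)
  rw [div_le_one (by positivity)]
  exact one_le_pow₀ (by norm_num)

/-! ## §2 The dressed scale-`0` grid covariance at the package: unweighted row / column sums `≤ 2·(N/β)·klScaleZeroA0` -/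

section KlEng

variable {L M : ℕ} [NeZero L] [NeZero M] {P : SplitConsts} {R : RenConsts} {c U β μ : ℝ} {Nsc : ℕ} {K : TrigPolyC4v}
  {S M' : Matrix (GridLeg (GridPoint L (2 * (2 * M)))) (GridLeg (GridPoint L (2 * (2 * M)))) ℂ}

omit [NeZero M] in
/-- **`ν` at the package**: `(|β|/N)·Σ_z ‖Ǩ_L z‖ ≤ (β/N)·klKappaFrameC R·U` for an admissible frame and `0 < U ≤ klEngU₀3 P R c`, `klBetaMin ≤ β`. -/
theorem nu_scaleZero_le_of_klEng (hR : R.WF) (hK : FrameOK R U Nsc μ K) (hβ : klBetaMin ≤ β) (hU : 0 < U) (hU₀ : U ≤ klEngU₀3 P R c) :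
    |β| / (((2 * (2 * M) : ℕ) : ℝ)) * ∑ z : TorusSite 2 L, ‖framePosKernel L K z‖ ≤
      β / (((2 * (2 * M) : ℕ) : ℝ)) * (klKappaFrameC R * U) := by
  have hβ0 : 0 < β := beta_pos_of_klBetaMin_le hβ
  rw [abs_of_pos hβ0]
  refine mul_le_mul_of_nonneg_left ?_ (by positivity)
  have h := sum_norm_framePosKernel_le_linear_of_frameOK (L := L) hR hU.ne' (abs_le_one_of_le_klEngU₀3 hU hU₀) hK
  rw [abs_of_pos hU] at h
  exact h

/-- **Unweighted row sums of the counterterm-dressed scale-`0` grid covariance at the engine's package**: for an admissible frame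
(`FrameOK R U Nsc μ K`, `R.WF`), `klBetaMin ≤ β`, `β³ ≤ M`, `0 < U ≤ klEngU₀3 P R c`, every `S` dominated by the grid counterterm matrix and
every `M'` with `M'·(1 + G·S) = 1`, `G = S_Nᵀ C^K_{>e₀} S_N` on the `N = 4M` grid:  `Σ_Y ‖(M'·G) X Y‖ ≤ 2·(N/β)·klScaleZeroA0`. -/
theorem rowSum_resummedScaleZeroCov_le_of_klEng (hR : R.WF) (hK : FrameOK R U Nsc μ K) (hβ : klBetaMin ≤ β) (hβM : β ^ 3 ≤ (M : ℝ))
    (hU : 0 < U) (hU₀ : U ≤ klEngU₀3 P R c)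
    (hS : ∀ X Y, ‖S X Y‖ ≤ ‖gridCounterMatrix L (2 * (2 * M)) β K X Y‖ + ‖gridCounterMatrix L (2 * (2 * M)) β K Y X‖)
    (hM : M' * (1 + (hubbardGridSub L M β (2 * (2 * M))).transpose * hubbardCovAboveCT L M β μ 0 K klE0 *
      hubbardGridSub L M β (2 * (2 * M)) * S) = 1)
    (X : GridLeg (GridPoint L (2 * (2 * M)))) :
    ∑ Y, ‖(M' * ((hubbardGridSub L M β (2 * (2 * M))).transpose * hubbardCovAboveCT L M β μ 0 K klE0 *
        hubbardGridSub L M β (2 * (2 * M)))) X Y‖ ≤ 2 * ((((2 * (2 * M) : ℕ) : ℝ)) / β * klScaleZeroA0) := by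
  have hβ0 : 0 < β := beta_pos_of_klBetaMin_le hβ
  have hN0 : 0 < (((2 * (2 * M) : ℕ) : ℝ)) := by have := NeZero.ne M; positivity
  have hA0 := klScaleZeroA0_pos
  set α : ℝ := (((2 * (2 * M) : ℕ) : ℝ)) / β * klScaleZeroA0 with hα
  set ν : ℝ := β / (((2 * (2 * M) : ℕ) : ℝ)) * (klKappaFrameC R * U) with hν
  have hαν : α * ν = klScaleZeroA0 * (klKappaFrameC R * U) := by
    rw [hα, hν]; field_simp
  have hhalf : α * ν ≤ 1 / 2 := by rw [hαν]; exact klScaleZeroA0_mul_klKappaFrameC_mul_le_half hR hU hU₀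
  have hαpos : 0 ≤ α := by positivity
  have h := rowSum_resummedGridCov_le_unweighted (β := β) (K := K) hM hS (fun X => rowSum_scaleZero_le_A0 hK hβ hβM X)
    (nu_scaleZero_le_of_klEng hR hK hβ hU hU₀) (by linarith) X
  refine h.trans ?_
  rw [div_le_iff₀ (by linarith)]
  nlinarith

/-- **Unweighted column sums of the counterterm-dressed scale-`0` grid covariance at the engine's package**: `Σ_X ‖(M'·G) X Y‖ ≤ 2·(N/β)·klScaleZeroA0`. -/
theorem colSum_resummedScaleZeroCov_le_of_klEng (hR : R.WF) (hK : FrameOK R U Nsc μ K) (hβ : klBetaMin ≤ β) (hβM : β ^ 3 ≤ (M : ℝ))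
    (hU : 0 < U) (hU₀ : U ≤ klEngU₀3 P R c)
    (hS : ∀ X Y, ‖S X Y‖ ≤ ‖gridCounterMatrix L (2 * (2 * M)) β K X Y‖ + ‖gridCounterMatrix L (2 * (2 * M)) β K Y X‖)
    (hM : M' * (1 + (hubbardGridSub L M β (2 * (2 * M))).transpose * hubbardCovAboveCT L M β μ 0 K klE0 *
      hubbardGridSub L M β (2 * (2 * M)) * S) = 1)
    (Y : GridLeg (GridPoint L (2 * (2 * M)))) :
    ∑ X, ‖(M' * ((hubbardGridSub L M β (2 * (2 * M))).transpose * hubbardCovAboveCT L M β μ 0 K klE0 *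
        hubbardGridSub L M β (2 * (2 * M)))) X Y‖ ≤ 2 * ((((2 * (2 * M) : ℕ) : ℝ)) / β * klScaleZeroA0) := by
  have hβ0 : 0 < β := beta_pos_of_klBetaMin_le hβ
  have hN0 : 0 < (((2 * (2 * M) : ℕ) : ℝ)) := by have := NeZero.ne M; positivity
  have hA0 := klScaleZeroA0_pos
  set α : ℝ := (((2 * (2 * M) : ℕ) : ℝ)) / β * klScaleZeroA0 with hα
  set ν : ℝ := β / (((2 * (2 * M) : ℕ) : ℝ)) * (klKappaFrameC R * U) with hν
  have hαν : α * ν = klScaleZeroA0 * (klKappaFrameC R * U) := by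
    rw [hα, hν]; field_simp
  have hhalf : α * ν ≤ 1 / 2 := by rw [hαν]; exact klScaleZeroA0_mul_klKappaFrameC_mul_le_half hR hU hU₀
  have hαpos : 0 ≤ α := by positivity
  have h := colSum_resummedGridCov_le_unweighted (β := β) (K := K) hM hS (fun Y => colSum_scaleZero_le_A0 hK hβ hβM Y)
    (nu_scaleZero_le_of_klEng hR hK hβ hU hU₀) (by linarith) Y
  refine h.trans ?_
  rw [div_le_iff₀ (by linarith)]
  nlinarith

/-- **The dressing exists at the package**: `1 + G·S` is invertible under the same hypotheses (so `M' := (1 + G·S)⁻¹` qualifies). -/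
theorem isUnit_one_add_scaleZeroCov_mul_of_klEng (hR : R.WF) (hK : FrameOK R U Nsc μ K) (hβ : klBetaMin ≤ β) (hβM : β ^ 3 ≤ (M : ℝ))
    (hU : 0 < U) (hU₀ : U ≤ klEngU₀3 P R c)
    (hS : ∀ X Y, ‖S X Y‖ ≤ ‖gridCounterMatrix L (2 * (2 * M)) β K X Y‖ + ‖gridCounterMatrix L (2 * (2 * M)) β K Y X‖) :
    IsUnit (1 + (hubbardGridSub L M β (2 * (2 * M))).transpose * hubbardCovAboveCT L M β μ 0 K klE0 *
      hubbardGridSub L M β (2 * (2 * M)) * S) := by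
  have hβ0 : 0 < β := beta_pos_of_klBetaMin_le hβ
  have hN0 : 0 < (((2 * (2 * M) : ℕ) : ℝ)) := by have := NeZero.ne M; positivity
  have hA0 := klScaleZeroA0_pos
  have hαν : (((2 * (2 * M) : ℕ) : ℝ)) / β * klScaleZeroA0 * (β / (((2 * (2 * M) : ℕ) : ℝ)) * (klKappaFrameC R * U)) =
      klScaleZeroA0 * (klKappaFrameC R * U) := by field_simp
  have hhalf := klScaleZeroA0_mul_klKappaFrameC_mul_le_half hR hU hU₀ (P := P) (c := c)
  exact isUnit_one_add_gridCov_mul_gridCounterAnti_unweighted (β := β) (K := K) hS (fun X => rowSum_scaleZero_le_A0 hK hβ hβM X)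
    (nu_scaleZero_le_of_klEng hR hK hβ hU hU₀) (by rw [hαν]; linarith)

/-- **Door to the registered binder**: the same row bound for `0 < U ≤ klEngU₀4 P R c` (`klEngU₀4 ≤ klEngU₀3`). -/
theorem rowSum_resummedScaleZeroCov_le_of_klEngU₀4 (hR : R.WF) (hK : FrameOK R U Nsc μ K) (hβ : klBetaMin ≤ β) (hβM : β ^ 3 ≤ (M : ℝ))
    (hU : 0 < U) (hU₀ : U ≤ klEngU₀4 P R c)
    (hS : ∀ X Y, ‖S X Y‖ ≤ ‖gridCounterMatrix L (2 * (2 * M)) β K X Y‖ + ‖gridCounterMatrix L (2 * (2 * M)) β K Y X‖)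
    (hM : M' * (1 + (hubbardGridSub L M β (2 * (2 * M))).transpose * hubbardCovAboveCT L M β μ 0 K klE0 *
      hubbardGridSub L M β (2 * (2 * M)) * S) = 1)
    (X : GridLeg (GridPoint L (2 * (2 * M)))) :
    ∑ Y, ‖(M' * ((hubbardGridSub L M β (2 * (2 * M))).transpose * hubbardCovAboveCT L M β μ 0 K klE0 *
        hubbardGridSub L M β (2 * (2 * M)))) X Y‖ ≤ 2 * ((((2 * (2 * M) : ℕ) : ℝ)) / β * klScaleZeroA0) :=
  rowSum_resummedScaleZeroCov_le_of_klEng hR hK hβ hβM hU (hU₀.trans (klEngU₀4_le_klEngU₀3 P R c)) hS hM X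

/-- **Door to the registered binder** (columns): `0 < U ≤ klEngU₀4 P R c`. -/
theorem colSum_resummedScaleZeroCov_le_of_klEngU₀4 (hR : R.WF) (hK : FrameOK R U Nsc μ K) (hβ : klBetaMin ≤ β) (hβM : β ^ 3 ≤ (M : ℝ))
    (hU : 0 < U) (hU₀ : U ≤ klEngU₀4 P R c)
    (hS : ∀ X Y, ‖S X Y‖ ≤ ‖gridCounterMatrix L (2 * (2 * M)) β K X Y‖ + ‖gridCounterMatrix L (2 * (2 * M)) β K Y X‖)
    (hM : M' * (1 + (hubbardGridSub L M β (2 * (2 * M))).transpose * hubbardCovAboveCT L M β μ 0 K klE0 *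
      hubbardGridSub L M β (2 * (2 * M)) * S) = 1)
    (Y : GridLeg (GridPoint L (2 * (2 * M)))) :
    ∑ X, ‖(M' * ((hubbardGridSub L M β (2 * (2 * M))).transpose * hubbardCovAboveCT L M β μ 0 K klE0 *
        hubbardGridSub L M β (2 * (2 * M)))) X Y‖ ≤ 2 * ((((2 * (2 * M) : ℕ) : ℝ)) / β * klScaleZeroA0) :=
  colSum_resummedScaleZeroCov_le_of_klEng hR hK hβ hβM hU (hU₀.trans (klEngU₀4_le_klEngU₀3 P R c)) hS hM Y

end KlEng

end Summit.HubbardSuperconductivity.HubbardSuperconductivity.Theorems.EngineV8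

end
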